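import Summits.QuantumFields.YangMills.Theorems.AllWindowsColdBoxBoxHighLineGhostQuadFormBound
import Summits.QuantumFields.YangMills.Theorems.AllWindowsColdBoxBoxHighLineGhostLogDetHS
import Summits.QuantumFields.YangMills.Theorems.AllWindowsColdBoxBoxHighLineSmallFieldSmallPlaquettes
import Summits.QuantumFields.YangMills.Theorems.AllWindowsColdBoxBoxHighLinePhiTaylor

/-!
# T-S5.7d `ghostTaylor : GhostTaylor` BY NAME — the Faddeev–Popov log-determinant in the edge chart to second order, no linear term,
# quadratic form of Hilbert–Schmidt size `O(H⁴)`, cubic remainder `C·H⁶(1+log H)⁴·t³`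
# (STUB-PLAN-S5-STEP2 §3/§8, task file ✓`…Theorems.AllWindowsColdBoxBoxHighLineStep2Wick`; LINE-19 S5 ⟨stmt-QuantumFields-24004⟩/⟨24335⟩)

Width seat `ym-line-sfw-p2-w3` (g40, cell `ym-idea-1`), routed by planner ym-idea-2 g18 (2026-08-29T19:46:09Z «w3: (iii) T-S5.7d»).

**Theorem (`ghostTaylor`, `m = 4`, `c₀ = 1/2688`).**  There are `C, c₀ > 0` such that for every `H ≥ 1` the matrix `M_H := GhostFP.ghostM H`
(✓`…GhostQuadForm`) satisfies `Σ M_{ij}² ≤ C·H⁴·(1+log H)⁴` and, for all `t ≥ 0` with `t·H² ≤ c₀` and all edge fields `‖a_e‖ ≤ t`,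
`|log|det F(U(a))| − log|det F(1)| − quadVal M_H a| ≤ C·H⁶·(1+log H)⁴·t³`.

Proof (assembly of the landed inputs).  `F(U(a)) − F₁ = A + B + R` (✓`fpOperator_edgeChart_sub_one`; linear / quadratic / cubic link parts,
`‖·‖ ≤ 3t, t²/2, t³` per link by ✓`norm_chartRem_le`), `X := F₁⁻¹(F(U(a)) − F₁) = X_A + X_B + X_R`, `F(U(a)) = F₁(1 + X)`.  The ℓ²-operator bound
`ρ = 1344·H²·t ≤ 1/2` (✓`ghost_opBound`, ✓`norm_coe_expPauli_sub_one_le`) feeds the Hilbert–Schmidt log-det expansion ✓`LogDetHS.logDet_hs`: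
`log|det(1+X)| = tr X − ½tr X² + r₃`, `|r₃| ≤ (2ρ/3)‖X‖²_HS`.  Then `tr X_A = 0` (✓`trace_ghostX_chartL`), `quadVal M_H a = tr X_B − ½ tr X_A²`
(✓`quadVal_ghostM`), `tr X² − tr X_A² = tr((X − X_A)(X + X_A))` and `|tr(PQ)| ≤ ‖P‖_HS‖Q‖_HS`; the sizes `‖X_W‖²_HS ≤ 20736·δ_W²·|I|·C_r(1+log H)⁴`
(✓`sum_sq_ghostX_le` + ✓`interiorGreen_row_sq_le`), `|tr X_R| ≤ 144·C_G·t³·|I|` (✓`abs_trace_ghostX_le`, ✓`ghostKernelDecay`), `|I| ≤ 16H⁴`, and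
`Σ M² ≤ ghostMConst(C_G)·H⁴` (✓`sum_sq_ghostM_le`) give the claim.

Everything proved, Mathlib + tree only, standard axioms; no definitions.  HONEST LABEL: ONE M/L brick (7d) of STEP 2 of the XL stub S5
(`stub_landauSecondOrder`) of a critic-PASSed DRAFT line; S5, U5, ⟨24004⟩ ⟨24335⟩ ⟨24336⟩ remain OPEN; no stub is closed by name, no crux, rung or
summit is proved; **the Yang–Mills mass gap is NOT proved by this file.**
-/

set_option autoImplicit false

noncomputable section

open Matrix Finset
open scoped Matrix.Norms.Operator
open Literature.MathematicalPhysics.QuantumFieldTheory.Balaban1983to89.B10Eq18SigmaSU2 (su2Coord)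
open Literature.MathematicalPhysics.QuantumFieldTheory.Balaban1983to89.B10Eq18SigmaSU2Haar (expPauli)
open Literature.MathematicalPhysics.QuantumFieldTheory.AxialGauge (boxEdges)
open Literature.MathematicalPhysics.QuantumLattice (LGConfig ZdEdge)
open Literature.Probability.LatticeModels (Site dirichletMatrix dirichletMatrix_transpose)

namespace Summit.QuantumFields.YangMills.Theorems.AllWindowsColdBoxBoxHighLine

namespace GhostTaylorProof

open GhostFP

variable {H : ℕ}

/-! ## Small matrix-analysis helpers -/

/-- `|tr(PQ)| ≤ √(Σ P² · Σ Q²)` (Cauchy–Schwarz over the entries). -/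
theorem abs_trace_mul_le_sqrt {ι : Type*} [Fintype ι] (P Q : Matrix ι ι ℝ) :
    |(P * Q).trace| ≤ Real.sqrt ((∑ i, ∑ j, P i j ^ 2) * ∑ i, ∑ j, Q i j ^ 2) := by
  have htr : (P * Q).trace = ∑ ij : ι × ι, P ij.1 ij.2 * Q ij.2 ij.1 := by
    rw [Matrix.trace, Fintype.sum_prod_type]
    simp only [Matrix.diag_apply, Matrix.mul_apply]
  have hP : ∑ i, ∑ j, P i j ^ 2 = ∑ ij : ι × ι, P ij.1 ij.2 ^ 2 := by rw [Fintype.sum_prod_type]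
  have hQ : ∑ i, ∑ j, Q i j ^ 2 = ∑ ij : ι × ι, Q ij.2 ij.1 ^ 2 := by
    rw [Fintype.sum_prod_type, Finset.sum_comm]
  rw [htr, hP, hQ]
  apply Real.abs_le_sqrt
  exact Finset.sum_mul_sq_le_sq_mul_sq _ _ _

/-- `Σ (P+Q)² ≤ 2(Σ P² + Σ Q²)`. -/
theorem sum_sq_add_le {ι : Type*} [Fintype ι] (P Q : Matrix ι ι ℝ) :
    ∑ i, ∑ j, (P + Q) i j ^ 2 ≤ 2 * (∑ i, ∑ j, P i j ^ 2 + ∑ i, ∑ j, Q i j ^ 2) := by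
  rw [mul_add, Finset.mul_sum, Finset.mul_sum, ← Finset.sum_add_distrib]
  refine Finset.sum_le_sum fun i _ => ?_
  rw [Finset.mul_sum, Finset.mul_sum, ← Finset.sum_add_distrib]
  refine Finset.sum_le_sum fun j _ => ?_
  rw [Matrix.add_apply]
  nlinarith [sq_nonneg (P i j - Q i j)]

/-- `Σ (P+Q+R)² ≤ 3(Σ P² + Σ Q² + Σ R²)`. -/
theorem sum_sq_add₃_le {ι : Type*} [Fintype ι] (P Q R : Matrix ι ι ℝ) :
    ∑ i, ∑ j, (P + Q + R) i j ^ 2 ≤ 3 * (∑ i, ∑ j, P i j ^ 2 + ∑ i, ∑ j, Q i j ^ 2 + ∑ i, ∑ j, R i j ^ 2) := by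
  rw [mul_add, mul_add, Finset.mul_sum, Finset.mul_sum, Finset.mul_sum, ← Finset.sum_add_distrib, ← Finset.sum_add_distrib]
  refine Finset.sum_le_sum fun i _ => ?_
  rw [Finset.mul_sum, Finset.mul_sum, Finset.mul_sum, ← Finset.sum_add_distrib, ← Finset.sum_add_distrib]
  refine Finset.sum_le_sum fun j _ => ?_
  rw [Matrix.add_apply, Matrix.add_apply]
  nlinarith [sq_nonneg (P i j - Q i j), sq_nonneg (Q i j - R i j), sq_nonneg (P i j - R i j)]

/-- The ghost propagator is symmetric. -/
theorem green_symm (x z : ↥(interiorSites H)) : (dirichletMatrix (interiorSites H))⁻¹ x z = (dirichletMatrix (interiorSites H))⁻¹ z x := by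
  have h : ((dirichletMatrix (interiorSites H))⁻¹)ᵀ = (dirichletMatrix (interiorSites H))⁻¹ := by
    rw [Matrix.transpose_nonsing_inv, dirichletMatrix_transpose]
  rw [← h, Matrix.transpose_apply, h]

/-- The final real arithmetic. -/
theorem final_arith {t h2 h4 h6 L Cr CG κ sA sB sR r3 trR trM : ℝ} (ht0 : 0 ≤ t) (ht1 : t ≤ 1) (hL : 1 ≤ L) (hCr : 0 ≤ Cr)
    (hCG : 0 ≤ CG) (hh2 : 0 ≤ h2) (hh4 : 0 ≤ h4) (hh6 : h2 * h4 = h6) (h46 : h4 ≤ h6) (hκ : κ = 20736 * h4 * (Cr * L))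
    (hsA0 : 0 ≤ sA) (hsA : sA ≤ 9 * κ * t ^ 2) (hsB0 : 0 ≤ sB) (hsB : sB ≤ κ * t ^ 4 / 4) (hsR0 : 0 ≤ sR) (hsR : sR ≤ κ * t ^ 6)
    (hr3 : |r3| ≤ 2 * (1344 * h2 * t) / 3 * (3 * (sA + sB + sR))) (htrR : |trR| ≤ 144 * CG * t ^ 3 * h4)
    (htrM : |trM| ≤ Real.sqrt ((2 * (sB + sR)) * (3 * (4 * sA + sB + sR)))) :
    |r3 + trR - 1 / 2 * trM| ≤ (571494528 * Cr + 144 * CG) * h6 * L * t ^ 3 := by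
  have hκ0 : 0 ≤ κ := by rw [hκ]; positivity
  have ht2 : t ^ 2 ≤ 1 := pow_le_one₀ ht0 ht1
  have ht4 : t ^ 4 ≤ t ^ 2 := by nlinarith [pow_nonneg ht0 2]
  have ht6 : t ^ 6 ≤ t ^ 2 := by nlinarith [pow_nonneg ht0 2, pow_nonneg ht0 4]
  have ht62 : t ^ 6 ≤ t ^ 4 := by nlinarith [pow_nonneg ht0 4]
  -- the square-root term
  have hM : |trM| ≤ 17 * κ * t ^ 3 := by
    refine htrM.trans ?_
    have hin : (2 * (sB + sR)) * (3 * (4 * sA + sB + sR)) ≤ (17 * κ * t ^ 3) ^ 2 := by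
      have h1 : sB + sR ≤ κ * t ^ 4 * (5 / 4) := by nlinarith
      have h2' : 4 * sA + sB + sR ≤ κ * t ^ 2 * (149 / 4) := by nlinarith
      have h10 : 0 ≤ sB + sR := by linarith
      have h20 : 0 ≤ 4 * sA + sB + sR := by linarith
      calc (2 * (sB + sR)) * (3 * (4 * sA + sB + sR)) = 6 * ((sB + sR) * (4 * sA + sB + sR)) := by ring
        _ ≤ 6 * ((κ * t ^ 4 * (5 / 4)) * (κ * t ^ 2 * (149 / 4))) := by
            refine mul_le_mul_of_nonneg_left (mul_le_mul h1 h2' h20 (by positivity)) (by norm_num)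
        _ = (6 * (5 / 4) * (149 / 4)) * (κ ^ 2 * t ^ 6) := by ring
        _ ≤ 289 * (κ ^ 2 * t ^ 6) := by nlinarith [mul_nonneg (sq_nonneg κ) (pow_nonneg ht0 6)]
        _ = (17 * κ * t ^ 3) ^ 2 := by ring
    calc Real.sqrt ((2 * (sB + sR)) * (3 * (4 * sA + sB + sR))) ≤ Real.sqrt ((17 * κ * t ^ 3) ^ 2) := Real.sqrt_le_sqrt hin
      _ = 17 * κ * t ^ 3 := Real.sqrt_sq (by positivity)
  -- the third-order term
  have hr : |r3| ≤ 27552 * (h2 * κ) * t ^ 3 := by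
    refine hr3.trans ?_
    have hs : sA + sB + sR ≤ κ * t ^ 2 * (41 / 4) := by nlinarith
    have : 2 * (1344 * h2 * t) / 3 * (3 * (sA + sB + sR)) = 2688 * h2 * t * (sA + sB + sR) := by ring
    rw [this]
    calc 2688 * h2 * t * (sA + sB + sR) ≤ 2688 * h2 * t * (κ * t ^ 2 * (41 / 4)) :=
          mul_le_mul_of_nonneg_left hs (by positivity)
      _ = 27552 * (h2 * κ) * t ^ 3 := by ring
  have hh2κ : h2 * κ = 20736 * h6 * (Cr * L) := by rw [hκ, ← hh6]; ring
  have htrR' : |trR| ≤ 144 * CG * h6 * L * t ^ 3 := by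
    refine htrR.trans ?_
    have : 144 * CG * t ^ 3 * h4 = 144 * CG * h4 * 1 * t ^ 3 := by ring
    rw [this]
    have hh6' : 0 ≤ h6 := hh4.trans h46
    have ht3 : 0 ≤ t ^ 3 := pow_nonneg ht0 3
    have h1 : 144 * CG * h4 * 1 ≤ 144 * CG * h6 * L :=
      mul_le_mul (mul_le_mul_of_nonneg_left h46 (by positivity)) hL zero_le_one (by positivity)
    exact mul_le_mul_of_nonneg_right h1 ht3
  have hκ6 : κ ≤ 20736 * h6 * (Cr * L) := by
    rw [hκ]
    exact mul_le_mul_of_nonneg_right (mul_le_mul_of_nonneg_left h46 (by norm_num)) (mul_nonneg hCr (by linarith))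
  calc |r3 + trR - 1 / 2 * trM| ≤ |r3 + trR| + |1 / 2 * trM| := abs_sub _ _
    _ ≤ |r3| + |trR| + 1 / 2 * |trM| := by rw [abs_mul, abs_of_pos (by norm_num : (0 : ℝ) < 1 / 2)]; linarith [abs_add_le r3 trR]
    _ ≤ 27552 * (h2 * κ) * t ^ 3 + 144 * CG * h6 * L * t ^ 3 + 1 / 2 * (17 * κ * t ^ 3) := by linarith [hr, htrR', hM]
    _ ≤ (571494528 * Cr + 144 * CG) * h6 * L * t ^ 3 := by
        rw [hh2κ]
        nlinarith [mul_le_mul_of_nonneg_right hκ6 (pow_nonneg ht0 3), mul_nonneg (mul_nonneg (hh4.trans h46) (mul_nonneg hCr (by linarith : (0:ℝ) ≤ L)))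
          (pow_nonneg ht0 3)]

end GhostTaylorProof

open GhostFP GhostTaylorProof in
/-- **T-S5.7d `GhostTaylor`, BY NAME** (`m = 4`, `c₀ = 1/2688`): the Faddeev–Popov log-determinant in the edge chart to second order with NO linear
term, the quadratic form `M_H = GhostFP.ghostM H` of Hilbert–Schmidt size `≤ C H⁴ (1+log H)⁴`, and a cubic remainder `≤ C H⁶ (1+log H)⁴ t³` for
`t·H² ≤ c₀`. -/
theorem ghostTaylor : GhostTaylor := by
  obtain ⟨CG₀, hK⟩ := ghostKernelDecay
  obtain ⟨Cr, hCr0, hrow⟩ := OrbitMapSurj.interiorGreen_row_sq_le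
  set CG : ℝ := max CG₀ 0 with hCGdef
  have hCG : 0 ≤ CG := le_max_right _ _
  refine ⟨ghostMConst CG + 16 * (571494528 * Cr + 144 * CG), 1 / 2688, 4, by norm_num, fun H hH => ?_⟩
  -- the Green's function facts at this `H`
  have hG0 : ∀ x z : ↥(interiorSites H), 0 ≤ (dirichletMatrix (interiorSites H))⁻¹ x z := fun x z => (hK H hH x z).1
  have hGd : ∀ x z : ↥(interiorSites H), (dirichletMatrix (interiorSites H))⁻¹ x z ≤ CG / (1 + siteDist (x : Site 4) (z : Site 4)) ^ 2 := by
    intro x z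
    refine (hK H hH x z).2.trans ?_
    have := GhostKernel.siteDist_nonneg (x : Site 4) (z : Site 4)
    exact div_le_div_of_nonneg_right (le_max_left _ _) (by positivity)
  have hGC : ∀ x z : ↥(interiorSites H), (dirichletMatrix (interiorSites H))⁻¹ x z ≤ CG := by
    intro x z
    refine (hGd x z).trans (div_le_self hCG ?_)
    have := GhostKernel.siteDist_nonneg (x : Site 4) (z : Site 4)
    exact one_le_pow₀ (by linarith)
  have hH' : (1 : ℝ) ≤ H := by exact_mod_cast hH
  have hlogH : 0 ≤ Real.log H := Real.log_nonneg hH'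
  set L : ℝ := (1 + Real.log H) ^ 4 with hLdef
  have hL : 1 ≤ L := one_le_pow₀ (by linarith)
  have hcol : ∀ z : ↥(interiorSites H), ∑ y, ((dirichletMatrix (interiorSites H))⁻¹ y z) ^ 2 ≤ Cr * L := by
    intro z
    have h := hrow H hH z
    rw [show (∑ y, ((dirichletMatrix (interiorSites H))⁻¹ y z) ^ 2) = ∑ y, ((dirichletMatrix (interiorSites H))⁻¹ z y) ^ 2 from
      Finset.sum_congr rfl fun y _ => by rw [green_symm]]
    exact h
  have hM0 : 0 ≤ ghostMConst CG := by rw [ghostMConst]; positivity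
  have hC2 : 0 ≤ 571494528 * Cr + 144 * CG := by positivity
  refine ⟨ghostM H, ?_, fun t a ht0 htH hat => ?_⟩
  · -- Hilbert–Schmidt size of the quadratic form
    have h := sum_sq_ghostM_le hH hG0 hCG hGd
    have hH4 : (0 : ℝ) ≤ (H : ℝ) ^ 4 := by positivity
    calc ∑ i, ∑ j, ghostM H i j ^ 2 ≤ ghostMConst CG * (H : ℝ) ^ 4 := h
      _ ≤ ghostMConst CG * (H : ℝ) ^ 4 * (1 + Real.log H) ^ 4 := le_mul_of_one_le_right (by positivity) hL
      _ ≤ (ghostMConst CG + 16 * (571494528 * Cr + 144 * CG)) * (H : ℝ) ^ 4 * (1 + Real.log H) ^ 4 := by gcongr; linarith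
  · -- the expansion
    have hc₀ : t * (H : ℝ) ^ 2 ≤ 1 / 2688 := htH
    have hH2 : (1 : ℝ) ≤ (H : ℝ) ^ 2 := one_le_pow₀ hH'
    have ht1 : t ≤ 1 := by nlinarith
    have hat' : ∀ e : ZdEdge 4, ‖freeVec H a e‖ ≤ t := fun e => SmallFieldPlaq.norm_freeVec_le (fun e => hat e) ht0 e
    have hH0 : (0 : ℝ) ≤ H := Nat.cast_nonneg H
    have hH4n : (0 : ℝ) ≤ 16 * (H : ℝ) ^ 4 := mul_nonneg (by norm_num) (pow_nonneg hH0 4)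
    have hH46 : 16 * (H : ℝ) ^ 4 ≤ 16 * (H : ℝ) ^ 6 := mul_le_mul_of_nonneg_left (pow_le_pow_right₀ hH' (by norm_num)) (by norm_num)
    have ht3 : 0 ≤ t ^ 3 := pow_nonneg ht0 3
    set U := edgeChart H a with hU
    set F₁ := fpOperator H 1 with hF₁
    set X := F₁⁻¹ * (fpOperator H U - F₁) with hX
    set XA := ghostX H (chartL H a)
    set XB := ghostX H (chartQ H a)
    set XR := ghostX H (chartR H a)
    have hXsplit : X = XA + XB + XR := by
      rw [hX, hU, fpOperator_edgeChart_sub_one, Matrix.mul_add, Matrix.mul_add]; rfl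
    -- link sizes
    have hδU : ∀ e ∈ boxEdges 4 (2 * H + 1), ‖((U e : SU2) : Matrix (Fin 2) (Fin 2) ℂ) - 1‖ ≤ 4 * t := by
      intro e _
      have h := norm_coe_expPauli_sub_one_le (freeVec H a e) ((hat' e).trans ht1)
      exact h.trans (by linarith [hat' e])
    have hδA : ∀ e ∈ boxEdges 4 (2 * H + 1), ‖chartL H a e‖ ≤ 3 * t := fun e _ =>
      (norm_su2Coord_chart_le (freeVec H a e)).trans (by linarith [hat' e])
    have hδB : ∀ e ∈ boxEdges 4 (2 * H + 1), ‖chartQ H a e‖ ≤ t ^ 2 / 2 := fun e _ => by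
      refine (norm_quadScalar_le (freeVec H a e)).trans ?_
      have := hat' e
      have h0 := norm_nonneg (freeVec H a e)
      nlinarith
    have hδR : ∀ e ∈ boxEdges 4 (2 * H + 1), ‖chartR H a e‖ ≤ t ^ 3 := fun e _ => by
      refine (norm_chartRem_le (freeVec H a e) ((hat' e).trans ht1)).trans ?_
      exact pow_le_pow_left₀ (norm_nonneg _) (hat' e) 3
    -- operator bound and the Hilbert–Schmidt log-det expansion
    set ρ : ℝ := 1344 * (H : ℝ) ^ 2 * t with hρ
    have hρ0 : 0 ≤ ρ := by positivity
    have hρ12 : ρ ≤ 1 / 2 := by rw [hρ]; nlinarith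
    have hop : ∀ v, X *ᵥ v ⬝ᵥ X *ᵥ v ≤ ρ ^ 2 * (v ⬝ᵥ v) := by
      intro v
      have h := ghost_opBound hH U hδU v
      rw [hρ]
      calc X *ᵥ v ⬝ᵥ X *ᵥ v ≤ (336 * (H : ℝ) ^ 2 * (4 * t)) ^ 2 * (v ⬝ᵥ v) := h
        _ = (1344 * (H : ℝ) ^ 2 * t) ^ 2 * (v ⬝ᵥ v) := by ring
    obtain ⟨hdet1X, hlog⟩ := LogDetHS.logDet_hs X hρ0 hρ12 hop
    -- `F(U) = F₁(1 + X)` and the log of the determinant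
    have hF₁unit : IsUnit F₁.det := SpectralFloor.isUnit_det_fpOperator_one hH
    have hFU : fpOperator H U = F₁ * (1 + X) := by
      rw [hX, Matrix.mul_add, Matrix.mul_one, ← Matrix.mul_assoc, Matrix.mul_nonsing_inv _ hF₁unit, Matrix.one_mul]
      abel
    have hlogdiff : Real.log |(fpOperator H U).det| - Real.log |F₁.det| = Real.log |(1 + X).det| := by
      rw [hFU, Matrix.det_mul, abs_mul, Real.log_mul (abs_ne_zero.2 hF₁unit.ne_zero) (abs_ne_zero.2 hdet1X)]
      ring
    -- (`positivity` would try to unfold these determinants when scanning hypotheses: drop them now)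
    clear hdet1X hF₁unit hFU
    -- traces and the quadratic form
    have htrA : XA.trace = 0 := trace_ghostX_chartL a
    have hq : quadVal (ghostM H) a = XB.trace - 1 / 2 * (XA * XA).trace := quadVal_ghostM a
    have htrX : X.trace = XB.trace + XR.trace := by rw [hXsplit, Matrix.trace_add, Matrix.trace_add, htrA, zero_add]
    have hsq : (X * X).trace - (XA * XA).trace = ((X - XA) * (X + XA)).trace := by
      rw [Matrix.sub_mul, Matrix.mul_add, Matrix.mul_add, Matrix.trace_sub, Matrix.trace_add, Matrix.trace_add,
        Matrix.trace_mul_comm XA X]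
      ring
    -- the identity behind the estimate
    set r3 := Real.log |(1 + X).det| - X.trace + (X * X).trace / 2 with hr3
    have hident : Real.log |(fpOperator H U).det| - Real.log |F₁.det| - quadVal (ghostM H) a =
        r3 + XR.trace - 1 / 2 * ((X - XA) * (X + XA)).trace := by
      rw [hlogdiff, hq, ← hsq, hr3, htrX]; ring
    -- Hilbert–Schmidt sizes
    have hnI16 : (Fintype.card ↥(interiorSites H) : ℝ) ≤ 16 * (H : ℝ) ^ 4 := by
      rw [Fintype.card_coe]; exact PhiTaylorProof.card_interiorSites_le H
    have hsA := sum_sq_ghostX_le hG0 hcol (chartL H a) hδA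
    have hsB := sum_sq_ghostX_le hG0 hcol (chartQ H a) hδB
    have hsR := sum_sq_ghostX_le hG0 hcol (chartR H a) hδR
    have htrR := abs_trace_ghostX_le hG0 hCG hGC (chartR H a) (pow_nonneg ht0 3) hδR
    generalize hcard : (Fintype.card ↥(interiorSites H) : ℝ) = nI at hnI16 hsA hsB hsR htrR
    set κ : ℝ := 20736 * (16 * (H : ℝ) ^ 4) * (Cr * L) with hκ
    have hCrL : 0 ≤ Cr * L := mul_nonneg hCr0 (by linarith)
    have hsA' : ∑ p, ∑ q, XA p q ^ 2 ≤ 9 * κ * t ^ 2 := by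
      have h0 : (0 : ℝ) ≤ 20736 * (3 * t) ^ 2 := mul_nonneg (by norm_num) (sq_nonneg _)
      have h1 : 20736 * (3 * t) ^ 2 * nI * (Cr * L) ≤ 20736 * (3 * t) ^ 2 * (16 * (H : ℝ) ^ 4) * (Cr * L) :=
        mul_le_mul_of_nonneg_right (mul_le_mul_of_nonneg_left hnI16 h0) hCrL
      refine (hsA.trans h1).trans (le_of_eq ?_)
      rw [hκ]; ring
    have hsB' : ∑ p, ∑ q, XB p q ^ 2 ≤ κ * t ^ 4 / 4 := by
      have h0 : (0 : ℝ) ≤ 20736 * (t ^ 2 / 2) ^ 2 := mul_nonneg (by norm_num) (sq_nonneg _)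
      have h1 : 20736 * (t ^ 2 / 2) ^ 2 * nI * (Cr * L) ≤ 20736 * (t ^ 2 / 2) ^ 2 * (16 * (H : ℝ) ^ 4) * (Cr * L) :=
        mul_le_mul_of_nonneg_right (mul_le_mul_of_nonneg_left hnI16 h0) hCrL
      refine (hsB.trans h1).trans (le_of_eq ?_)
      rw [hκ]; ring
    have hsR' : ∑ p, ∑ q, XR p q ^ 2 ≤ κ * t ^ 6 := by
      have h0 : (0 : ℝ) ≤ 20736 * (t ^ 3) ^ 2 := mul_nonneg (by norm_num) (sq_nonneg _)
      have h1 : 20736 * (t ^ 3) ^ 2 * nI * (Cr * L) ≤ 20736 * (t ^ 3) ^ 2 * (16 * (H : ℝ) ^ 4) * (Cr * L) :=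
        mul_le_mul_of_nonneg_right (mul_le_mul_of_nonneg_left hnI16 h0) hCrL
      refine (hsR.trans h1).trans (le_of_eq ?_)
      rw [hκ]; ring
    have hsX : ∑ p, ∑ q, X p q ^ 2 ≤ 3 * (∑ p, ∑ q, XA p q ^ 2 + ∑ p, ∑ q, XB p q ^ 2 + ∑ p, ∑ q, XR p q ^ 2) := by
      rw [hXsplit]; exact sum_sq_add₃_le XA XB XR
    have hr3b : |r3| ≤ 2 * (1344 * (H : ℝ) ^ 2 * t) / 3 * (3 * (∑ p, ∑ q, XA p q ^ 2 + ∑ p, ∑ q, XB p q ^ 2 + ∑ p, ∑ q, XR p q ^ 2)) :=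
      hlog.trans (mul_le_mul_of_nonneg_left hsX
        (div_nonneg (mul_nonneg (by norm_num : (0 : ℝ) ≤ 2) (mul_nonneg (mul_nonneg (by norm_num : (0 : ℝ) ≤ 1344) (pow_nonneg hH0 2)) ht0))
          (by norm_num : (0 : ℝ) ≤ 3)))
    have htrRb : |XR.trace| ≤ 144 * CG * t ^ 3 * (16 * (H : ℝ) ^ 4) := by
      refine htrR.trans ?_
      have : 0 ≤ 144 * CG * t ^ 3 := mul_nonneg (mul_nonneg (by norm_num) hCG) ht3
      exact mul_le_mul_of_nonneg_left hnI16 this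
    have hA0 : 0 ≤ ∑ p, ∑ q, XA p q ^ 2 := Finset.sum_nonneg fun p _ => Finset.sum_nonneg fun q _ => sq_nonneg _
    have hB0 : 0 ≤ ∑ p, ∑ q, XB p q ^ 2 := Finset.sum_nonneg fun p _ => Finset.sum_nonneg fun q _ => sq_nonneg _
    have hR0 : 0 ≤ ∑ p, ∑ q, XR p q ^ 2 := Finset.sum_nonneg fun p _ => Finset.sum_nonneg fun q _ => sq_nonneg _
    have htrMb : |((X - XA) * (X + XA)).trace| ≤
        Real.sqrt ((2 * (∑ p, ∑ q, XB p q ^ 2 + ∑ p, ∑ q, XR p q ^ 2)) * (3 * (4 * ∑ p, ∑ q, XA p q ^ 2 + ∑ p, ∑ q, XB p q ^ 2 + ∑ p, ∑ q, XR p q ^ 2))) := by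
      refine (abs_trace_mul_le_sqrt _ _).trans (Real.sqrt_le_sqrt ?_)
      have h1 : ∑ p, ∑ q, (X - XA) p q ^ 2 ≤ 2 * (∑ p, ∑ q, XB p q ^ 2 + ∑ p, ∑ q, XR p q ^ 2) := by
        rw [show X - XA = XB + XR by rw [hXsplit]; abel]; exact sum_sq_add_le XB XR
      have h2 : ∑ p, ∑ q, (X + XA) p q ^ 2 ≤ 3 * (4 * ∑ p, ∑ q, XA p q ^ 2 + ∑ p, ∑ q, XB p q ^ 2 + ∑ p, ∑ q, XR p q ^ 2) := by
        rw [show X + XA = (XA + XA) + XB + XR by rw [hXsplit]; abel]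
        refine (sum_sq_add₃_le (XA + XA) XB XR).trans ?_
        have : ∑ p, ∑ q, (XA + XA) p q ^ 2 = 4 * ∑ p, ∑ q, XA p q ^ 2 := by
          rw [Finset.mul_sum]; refine Finset.sum_congr rfl fun p _ => ?_
          rw [Finset.mul_sum]; refine Finset.sum_congr rfl fun q _ => ?_
          rw [Matrix.add_apply]; ring
        rw [this]
      exact mul_le_mul h1 h2 (Finset.sum_nonneg fun p _ => Finset.sum_nonneg fun q _ => sq_nonneg _)
        (mul_nonneg (by norm_num : (0 : ℝ) ≤ 2) (add_nonneg hB0 hR0))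
    -- conclude
    rw [hident]
    have hfin := final_arith (h2 := (H : ℝ) ^ 2) (h4 := 16 * (H : ℝ) ^ 4) (h6 := 16 * (H : ℝ) ^ 6) ht0 ht1 hL hCr0 hCG (pow_nonneg hH0 2)
      hH4n (by ring) hH46 hκ hA0 hsA' hB0 hsB' hR0 hsR' hr3b htrRb htrMb
    refine hfin.trans ?_
    have hH6 : (0 : ℝ) ≤ (H : ℝ) ^ 6 := pow_nonneg hH0 6
    have hL0 : 0 ≤ (1 + Real.log H) ^ 4 := pow_nonneg (add_nonneg zero_le_one hlogH) 4
    have hcoef : 16 * (571494528 * Cr + 144 * CG) ≤ ghostMConst CG + 16 * (571494528 * Cr + 144 * CG) := le_add_of_nonneg_left hM0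
    calc (571494528 * Cr + 144 * CG) * (16 * (H : ℝ) ^ 6) * L * t ^ 3
        = (16 * (571494528 * Cr + 144 * CG)) * (H : ℝ) ^ 6 * (1 + Real.log H) ^ 4 * t ^ 3 := by rw [hLdef]; ring
      _ ≤ (ghostMConst CG + 16 * (571494528 * Cr + 144 * CG)) * (H : ℝ) ^ 6 * (1 + Real.log H) ^ 4 * t ^ 3 :=
          mul_le_mul_of_nonneg_right (mul_le_mul_of_nonneg_right (mul_le_mul_of_nonneg_right hcoef hH6) hL0) ht3

end Summit.QuantumFields.YangMills.Theorems.AllWindowsColdBoxBoxHighLine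

end
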